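import Summits.FinalStateConjecture.FinalStateConjecture.Theses.EIHFluxBalance
import Summits.FinalStateConjecture.FinalStateConjecture.Theorems.EIHFluxBalanceInertialRecessionStubQuasiStationarityReduction
import Summits.FinalStateConjecture.FinalStateConjecture.Theorems.EIHFluxBalanceInertialRecessionStubChargeModelUnpack
import Literature.Geometry.Lorentzian.IsometryProofs
import Literature.Geometry.Lorentzian.ChartCalculus

/-!
# Route EIHFluxBalance — `InertialRecession`, line `sublinear-is-free-clean-window-charges`,
# stub `stub_weightedQuasiStationarity` (= item stmt-FinalStateConjecture-16928): QS IS A PROPERTY OF THE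
# TRUE LAB METRIC (reduction of the stub to true-field quasi-stationarity, and the converse)

Helper file (`--supports stmt-FinalStateConjecture-10166`) of the worker on the registered stub
`stub_weightedQuasiStationarity` (skeleton r11 of the line; byte-identical with the route item
`WeightedQuasiStationarity`, stmt-FinalStateConjecture-16928).

The stub asks, under the crux antecedent with `0 < N` and third-order slaving, for QUASI-STATIONARITY
(QS) of the modulated multi-Kerr–Schild background `G(λ(·))`: for every exclusion radius `ρ(t) → ∞`,
the `(1 + d^{7/4})`-weighted sup over the cone-slab points at distance `d ≥ ρ(t)` from all painted
centres of `‖DG(x)[e₀]‖` tends to `0`. This file proves that, granted only the kinematic / domain /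
smoothness clauses of the antecedent and its weighted `C³` clause (in fact only `m = 1` of it), QS is
EQUIVALENT to the same statement for the TRUE LAB METRIC `lab = G + deviationExtend B Φ = Φ^* g`
(`lab_eq_pullbackBilin`, = `LabMetric.bilin_add_deviationExtend_eq_pullbackBilin`), whose LL charges the
landed charge model (`…StubChargeModelWindowLawMain.windowLaw`,
`…StubIdentificationMain.cleanWindowCharges_identification`) integrates:

* `eventually_weighted_abs_sub_le` — the core estimate: for every `ρ → ∞` and `ε > 0`, eventually in
  `t`, at every cone-slab point `x` with `d(x) ≥ ρ(t)` one has `x ∈ U`, and the weighted sizes of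
  `DG(x)[e₀]` and `D lab(x)[e₀]` differ by at most `ε` (their difference is `Dh(x)[e₀]`,
  `h = deviationExtend B Φ`, and `(1 + d^{7/4})‖Dh(x)‖ ≤ ε` is the `m = 1` weighted clause; the point
  lies in `U` by the domain clause, `G` is differentiable there because every painted rest position is
  off the ring, `lab` because `Φ^* g` is a smooth section);
* `trueField_of_quasiStationarity`, `quasiStationarity_of_trueField`, `quasiStationarity_iff_trueField`
  — QS for `G` ⟺ QS for `lab` ("TFQS"), for every exclusion radius;
* `weightedQuasiStationarity_of_trueField` — the REGISTERED SIGNATURE of the stub verbatim with ONE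
  hypothesis inserted before the conclusion: TFQS, written with the lab field spelled exactly as in the
  window law. This is the reduction theorem of the stub to its honest residual input;
* `trueField_of_weightedQuasiStationarity` — the converse in the same shape (QS ⇒ TFQS): under the
  antecedent the stub IS "`(1 + d^{7/4})‖∂₀(Φ^* g)(x)‖ → 0` uniformly on the cone slabs beyond any
  `ρ(t) → ∞`", a late-quietness RATE of the vacuum metric in the lab chart involving the painting only
  through the centres `ξᵢ` (via `d`); so QS is invariant under admissible repainting (companion file
  `…StubQS11Repainting`), unlike the per-hole rate RATES_E0 (`…StubWeightedRatesNecessityQS`).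

WHY TFQS IS THE RESIDUAL (numbers in `…StubQS11Repainting`): slab-local vacuum identities give pointwise
`M|u̇| ≲ εR^{1/4} + M²R^{-2}` and WINDOWED average group rates `≲ εR^{-3/4} + M²R^{-2}`, never the
pointwise `o(R^{-3/4})` QS needs at every scale up to `R ≍ t`; the missing input is propagation /
no-incoming-radiation content of the development, i.e. a RATE for `∂ₜ(Φ^* g)`.
-/

set_option linter.dupNamespace false
set_option maxSynthPendingDepth 3 -- nested operator spaces (as in `CoordCurvature.lean`)

noncomputable section

open scoped BigOperators Topology Manifold ContDiff ENNReal
open Filter Set Function TopologicalSpace Literature.Geometry.Lorentzian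

namespace Summit.FinalStateConjecture.FinalStateConjecture.Theorems

namespace SublinearIsFree.TrueFieldQS

open Summit.FinalStateConjecture.FinalStateConjecture.Theorems.SublinearIsFree.QuasiStationarity

/-- Weighted reverse triangle inequality: `|w‖u‖ − w‖u + v‖| ≤ w‖v‖` for `w ≥ 0`. [folklore] -/
theorem abs_weight_mul_norm_sub_le {F : Type*} [SeminormedAddCommGroup F] {w : ℝ} (hw : 0 ≤ w)
    (u v : F) : |w * ‖u‖ - w * ‖u + v‖| ≤ w * ‖v‖ := by
  rw [← mul_sub, abs_mul, abs_of_nonneg hw]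
  refine mul_le_mul_of_nonneg_left ?_ hw
  have h1 : ‖u + v‖ ≤ ‖u‖ + ‖v‖ := norm_add_le u v
  have h2 : ‖u‖ ≤ ‖u + v‖ + ‖v‖ := by
    have := norm_sub_le (u + v) v
    rwa [add_sub_cancel_right] at this
  rw [abs_le]
  constructor <;> linarith

/-- `‖L e₀‖ ≤ ‖L‖` for a continuous linear map on `E4` (`‖e₀‖ = 1`). [folklore] -/
theorem norm_apply_basisVector_zero_le {F : Type*} [SeminormedAddCommGroup F] [NormedSpace ℝ F]
    (L : E4 →L[ℝ] F) : ‖L (E4.basisVector 0)‖ ≤ ‖L‖ := by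
  have h := L.le_opNorm (E4.basisVector 0)
  have h1 : ‖E4.basisVector 0‖ = 1 := by simp [E4.basisVector]
  rwa [h1, mul_one] at h

-- the algebraic and the operator-norm instance paths on `E4 →L[ℝ] E4 →L[ℝ] ℝ` unify slowly
set_option synthInstance.maxHeartbeats 400000 in
set_option maxHeartbeats 1600000 in
/-- **Core estimate.** For the crux's lab chart (smooth chart map `Φ`, modulated multi-Kerr–Schild
background `G` with smooth moduli, domain clause, weighted `C³` decay clause of the deviation
`h = deviationExtend B Φ`) and every threshold `ρ → ∞` and `ε > 0`: eventually in `t`, every cone-slab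
point `x` (`x⁰ = t`, `‖x̲‖ ≤ κt`) at distance `d(x) = ⨅ᵢ ‖x̲ − ξᵢ(t)‖ ≥ ρ(t)` from the centres lies in
`U`, and `|(1 + d^{7/4})‖DG(x)e₀‖ − (1 + d^{7/4})‖D(G + h)(x)e₀‖| ≤ ε`. Proof: `x ∈ U` by the domain
clause (as in `KSDecay.mem_domain_of_far`); `G` is differentiable at `x` (lab distance `≥ max 1 (2|aᵢ|)`
from every centre, `contDiffAt_summand`), `G + h` is (`Φ^* g` is a smooth section of the bundle of
bilinear forms, `contMDiff_pullbackBilin_holds` + `OpensChart.contMDiffAt_bilinSection_iff`, as in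
`LabMetric.contDiffOn_bilin_add_deviationExtend`), hence so is
`h` and `D(G + h)(x)e₀ − DG(x)e₀ = Dh(x)e₀`, whose weighted norm is `≤ ε` by the `m = 1` weighted
clause (`WindowBounds.weightedClause_pointwise`). [folklore] -/
theorem eventually_weighted_abs_sub_le (𝓢 : Spacetime 4) {N : ℕ} (M a rin : Fin N → ℝ)
    (Λ : Fin N → ℝ → lorentzGroup) (ξ : Fin N → ℝ → E3) (κ τ₀ : ℝ) (U : Opens E4)
    (Φ : U → 𝓢.carrier) (hrin : ∀ i, 0 ≤ rin i)
    (hΛ : ∀ i, ContDiff ℝ ∞ (fun t ↦ ((Λ i t : E4 ≃L[ℝ] E4) : E4 →L[ℝ] E4)))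
    (hξ : ∀ i, ContDiff ℝ ∞ (ξ i))
    (hU : {x : E4 | τ₀ < x 0 ∧ ∀ i, rin i < Kerr.radius (a i)
      (poincareInv (Λ i (x 0)) (E4.ofTimeSpace (x 0) (ξ i (x 0))) x)} ⊆ (U : Set E4))
    (hΦ : ContMDiff 𝓘(ℝ, E4) (𝓡 4) ∞ Φ)
    (hWt : Tendsto (fun t : ℝ ↦ ⨆ x ∈ {x : U | x.1 0 = t ∧ E4.spatialNorm x.1 ≤ κ * t},
      ⨆ (m : ℕ) (_ : m ≤ 3), ENNReal.ofReal (1 + √(√((⨅ i, ‖E4.spatial x.1 - ξ i t‖) ^ 7))) *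
        ‖iteratedFDeriv ℝ m (𝓢.deviationExtend (⟨U, fun x ↦ Minkowski.bilin + ∑ i, (boostedKerrBilin (Λ i (x 0)) (E4.ofTimeSpace (x 0) (ξ i (x 0))) (M i) (a i) x - Minkowski.bilin), fun x ↦ x 0, E4.spatialNorm⟩ : ModelBackground) Φ) x.1‖ₑ) atTop (𝓝 0))
    {ρ : ℝ → ℝ} (hρ : Tendsto ρ atTop atTop) {ε : ℝ} (hε : 0 < ε) :
    ∀ᶠ t in atTop, ∀ x : E4, x 0 = t → E4.spatialNorm x ≤ κ * t → ρ t ≤ ⨅ i, ‖E4.spatial x - ξ i t‖ →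
      x ∈ (U : Set E4) ∧
      |(1 + √(√((⨅ i, ‖E4.spatial x - ξ i t‖) ^ 7))) *
          ‖fderiv ℝ (fun y : E4 ↦ Minkowski.bilin + ∑ i, (boostedKerrBilin (Λ i (y 0)) (E4.ofTimeSpace (y 0) (ξ i (y 0))) (M i) (a i) y - Minkowski.bilin)) x (E4.basisVector 0)‖ -
        (1 + √(√((⨅ i, ‖E4.spatial x - ξ i t‖) ^ 7))) *
          ‖fderiv ℝ (fun y : E4 ↦ (Minkowski.bilin + ∑ i, (boostedKerrBilin (Λ i (y 0)) (E4.ofTimeSpace (y 0) (ξ i (y 0))) (M i) (a i) y - Minkowski.bilin)) + 𝓢.deviationExtend (⟨U, fun x ↦ Minkowski.bilin + ∑ i, (boostedKerrBilin (Λ i (x 0)) (E4.ofTimeSpace (x 0) (ξ i (x 0))) (M i) (a i) x - Minkowski.bilin), fun x ↦ x 0, E4.spatialNorm⟩ : ModelBackground) Φ y) x (E4.basisVector 0)‖| ≤ ε := by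
  -- names for the background, the reference data and the deviation
  set G : E4 → E4 →L[ℝ] E4 →L[ℝ] ℝ := fun x ↦ Minkowski.bilin + ∑ i, (boostedKerrBilin (Λ i (x 0)) (E4.ofTimeSpace (x 0) (ξ i (x 0))) (M i) (a i) x - Minkowski.bilin) with hGdef
  set B : ModelBackground := ⟨U, G, fun x ↦ x 0, E4.spatialNorm⟩ with hBdef
  set h : E4 → E4 →L[ℝ] E4 →L[ℝ] ℝ := 𝓢.deviationExtend B Φ with hhdef
  -- `C¹` regularity of the moduli
  have hΛ1 : ∀ i, ContDiff ℝ 1 (fun t ↦ ((Λ i t : E4 ≃L[ℝ] E4) : E4 →L[ℝ] E4)) := fun i ↦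
    (hΛ i).of_le (by exact_mod_cast le_top)
  have hξ1 : ∀ i, ContDiff ℝ 1 (ξ i) := fun i ↦ (hξ i).of_le (by exact_mod_cast le_top)
  -- the threshold the distance to the centres must exceed
  set Amax : ℝ := ∑ i, (|a i| + rin i) with hAmax
  have hAi : ∀ i, |a i| + rin i ≤ Amax := fun i ↦
    Finset.single_le_sum (f := fun i ↦ |a i| + rin i) (fun i _ ↦ by have := hrin i; positivity)
      (Finset.mem_univ i)
  have hAmax0 : 0 ≤ Amax := Finset.sum_nonneg fun i _ ↦ by have := hrin i; positivity
  set L₀ : ℝ := 2 + 2 * Amax with hL₀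
  -- eventual facts, merged
  have hev : ∀ᶠ t in atTop, L₀ ≤ ρ t ∧ τ₀ < t ∧
      (∀ x : E4, x ∈ (U : Set E4) → x 0 = t → E4.spatialNorm x ≤ κ * t → ∀ m : ℕ, m ≤ 3 →
        (1 + √(√((⨅ i, ‖E4.spatial x - ξ i t‖) ^ 7))) * ‖iteratedFDeriv ℝ m h x‖ ≤ ε) := by
    have h1 : ∀ᶠ t in atTop, L₀ ≤ ρ t := (tendsto_atTop.1 hρ) L₀
    have h2 : ∀ᶠ t in atTop, τ₀ < t := eventually_gt_atTop τ₀
    have h3 := WindowBounds.weightedClause_pointwise (U := U) (h := h) hWt hε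
    filter_upwards [h1, h2, h3] with t ht1 ht2 ht3
    exact ⟨ht1, ht2, ht3⟩
  filter_upwards [hev] with s hs
  obtain ⟨hL, hτ, hWs⟩ := hs
  intro x hx0 hxκ hxρ
  -- the point and its distances to the centres
  set d : ℝ := ⨅ i, ‖E4.spatial x - ξ i s‖ with hddef
  have hdL : L₀ ≤ d := hL.trans hxρ
  have hdi : ∀ i, d ≤ ‖E4.spatial x - ξ i s‖ := fun i ↦ WindowBounds.iInf_norm_sub_le (fun j ↦ ξ j s) i
  have hdist : ∀ i, L₀ ≤ ‖E4.spatial x - ξ i s‖ := fun i ↦ hdL.trans (hdi i)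
  -- membership in the chart domain (the argument of `KSDecay.mem_domain_of_far`, inlined)
  have hxU : x ∈ (U : Set E4) := by
    refine hU ⟨by rw [hx0]; exact hτ, fun i ↦ ?_⟩
    have hsq := sq_sub_sq_le_radius_poincareInv_sq (Λ i (x 0)) (a i) (x 0) (ξ i (x 0)) (x := x) rfl
    have hr := Kerr.radius_nonneg (a i) (poincareInv (Λ i (x 0)) (E4.ofTimeSpace (x 0) (ξ i (x 0))) x)
    have h1 : rin i + |a i| + 1 ≤ ‖E4.spatial x - ξ i (x 0)‖ := by
      rw [hx0]
      have h1 := hdist i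
      have h2 := hAi i
      linarith
    have h2 : (rin i + |a i| + 1) ^ 2 ≤ ‖E4.spatial x - ξ i (x 0)‖ ^ 2 :=
      pow_le_pow_left₀ (by have := hrin i; positivity) h1 2
    refine lt_of_pow_lt_pow_left₀ 2 hr ?_
    nlinarith [abs_nonneg (a i), hrin i, sq_abs (a i)]
  -- differentiability of `G`, `lab`, `h` at `x`
  have hfar : ∀ i, max 1 (2 * |a i|) ≤ ‖E4.spatial x - ξ i s‖ := fun i ↦ by
    refine max_le ?_ ?_
    · have h1 := hdist i
      linarith
    · have h1 := hdist i
      have h2 := hAi i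
      have h3 := hrin i
      linarith
  have hdiff := fun i ↦ (contDiffAt_summand (M := M i) (a := a i) (hΛ1 i) (hξ1 i) hx0
    (hfar i)).differentiableAt one_ne_zero
  have hGd : DifferentiableAt ℝ G x :=
    DifferentiableAt.const_add (𝕜 := ℝ) (E := E4) (F := E4 →L[ℝ] E4 →L[ℝ] ℝ) Minkowski.bilin
      (differentiableAt_finset_sum_forms Finset.univ
        (S := fun i (y : E4) ↦ boostedKerrBilin (Λ i (y 0)) (E4.ofTimeSpace (y 0) (ξ i (y 0))) (M i)
          (a i) y - Minkowski.bilin) fun i _ ↦ hdiff i)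
  have hlabd : DifferentiableAt ℝ (fun z ↦ B.bilin z + 𝓢.deviationExtend B Φ z) x := by
    -- the argument of `LabMetric.contDiffOn_bilin_add_deviationExtend`, inlined
    have hsec := PseudoRiemannianMetric.contMDiff_pullbackBilin_holds (I := 𝓡 4) (M := 𝓢.carrier)
      (I' := 𝓘(ℝ, E4)) (N := B.domain) (n := ∞) Φ hΦ 𝓢.metric.toPseudoRiemannianMetric
    have heq : ∀ y : B.domain, (show E4 →L[ℝ] E4 →L[ℝ] ℝ from
        pullbackBilin (I := 𝓡 4) (I' := 𝓘(ℝ, E4)) Φ 𝓢.metric.val y) =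
        B.bilin y.1 + 𝓢.deviationExtend B Φ y.1 := fun y ↦ by
      refine ContinuousLinearMap.ext fun v ↦ ContinuousLinearMap.ext fun w ↦ ?_
      rw [add_apply, add_apply, 𝓢.deviationExtend_coe, Spacetime.deviation_apply, add_comm, sub_add_cancel]
      rfl
    have hat : ContDiffAt ℝ ∞ (fun z ↦ B.bilin z + 𝓢.deviationExtend B Φ z) x :=
      (OpensChart.contMDiffAt_bilinSection_iff ⟨x, hxU⟩
        (fun y ↦ pullbackBilin (I := 𝓡 4) (I' := 𝓘(ℝ, E4)) Φ 𝓢.metric.val y)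
        (fun z ↦ B.bilin z + 𝓢.deviationExtend B Φ z) heq).1 (hsec ⟨x, hxU⟩)
    exact hat.differentiableAt (by simp)
  have hhd : DifferentiableAt ℝ h x := by
    have : h = fun z ↦ (B.bilin z + 𝓢.deviationExtend B Φ z) - G z :=
      funext fun z ↦ (add_sub_cancel_left (G z) (h z)).symm
    rw [this]
    exact hlabd.sub hGd
  -- the difference of the two lab-time derivatives is `Dh(x)e₀`
  have hsplit : fderiv ℝ (fun z ↦ G z + h z) x (E4.basisVector 0) =
      fderiv ℝ G x (E4.basisVector 0) + fderiv ℝ h x (E4.basisVector 0) := by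
    rw [fderiv_fun_add hGd hhd, add_apply]
  -- the `m = 1` weighted clause at `x`
  have hW1 : (1 + √(√(d ^ 7))) * ‖fderiv ℝ h x (E4.basisVector 0)‖ ≤ ε := by
    have h1 := hWs x hxU hx0 hxκ 1 (by norm_num)
    rw [norm_iteratedFDeriv_one] at h1
    have hw0 : 0 ≤ 1 + √(√(d ^ 7)) := by positivity
    exact (mul_le_mul_of_nonneg_left (norm_apply_basisVector_zero_le (fderiv ℝ h x)) hw0).trans h1
  refine ⟨hxU, ?_⟩
  change |(1 + √(√(d ^ 7))) * ‖fderiv ℝ G x (E4.basisVector 0)‖ -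
      (1 + √(√(d ^ 7))) * ‖fderiv ℝ (fun z ↦ G z + h z) x (E4.basisVector 0)‖| ≤ ε
  rw [hsplit]
  exact (abs_weight_mul_norm_sub_le (by positivity) _ _).trans hW1

-- the algebraic and the operator-norm instance paths on `E4 →L[ℝ] E4 →L[ℝ] ℝ` unify slowly
set_option synthInstance.maxHeartbeats 400000 in
set_option maxHeartbeats 1600000 in
/-- **QS ⇒ TFQS.** Under the hypotheses of `eventually_weighted_abs_sub_le`: if the modulated
background `G` is quasi-stationary at the weighted rate beyond every `ρ(t) → ∞`, so is the true lab
metric `G + deviationExtend B Φ = Φ^* g`. [folklore] -/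
theorem trueField_of_quasiStationarity (𝓢 : Spacetime 4) {N : ℕ} (M a rin : Fin N → ℝ)
    (Λ : Fin N → ℝ → lorentzGroup) (ξ : Fin N → ℝ → E3) (κ τ₀ : ℝ) (U : Opens E4)
    (Φ : U → 𝓢.carrier) (hrin : ∀ i, 0 ≤ rin i)
    (hΛ : ∀ i, ContDiff ℝ ∞ (fun t ↦ ((Λ i t : E4 ≃L[ℝ] E4) : E4 →L[ℝ] E4)))
    (hξ : ∀ i, ContDiff ℝ ∞ (ξ i))
    (hU : {x : E4 | τ₀ < x 0 ∧ ∀ i, rin i < Kerr.radius (a i)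
      (poincareInv (Λ i (x 0)) (E4.ofTimeSpace (x 0) (ξ i (x 0))) x)} ⊆ (U : Set E4))
    (hΦ : ContMDiff 𝓘(ℝ, E4) (𝓡 4) ∞ Φ)
    (hWt : Tendsto (fun t : ℝ ↦ ⨆ x ∈ {x : U | x.1 0 = t ∧ E4.spatialNorm x.1 ≤ κ * t},
      ⨆ (m : ℕ) (_ : m ≤ 3), ENNReal.ofReal (1 + √(√((⨅ i, ‖E4.spatial x.1 - ξ i t‖) ^ 7))) *
        ‖iteratedFDeriv ℝ m (𝓢.deviationExtend (⟨U, fun x ↦ Minkowski.bilin + ∑ i, (boostedKerrBilin (Λ i (x 0)) (E4.ofTimeSpace (x 0) (ξ i (x 0))) (M i) (a i) x - Minkowski.bilin), fun x ↦ x 0, E4.spatialNorm⟩ : ModelBackground) Φ) x.1‖ₑ) atTop (𝓝 0))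
    (hQ : ∀ ρ : ℝ → ℝ, Tendsto ρ atTop atTop → Tendsto (fun t : ℝ ↦ ⨆ x ∈ {x : E4 | x 0 = t ∧
      E4.spatialNorm x ≤ κ * t ∧ ρ t ≤ ⨅ i, ‖E4.spatial x - ξ i t‖},
        ENNReal.ofReal (1 + √(√((⨅ i, ‖E4.spatial x - ξ i t‖) ^ 7))) *
          ‖fderiv ℝ (fun y : E4 ↦ Minkowski.bilin + ∑ i, (boostedKerrBilin (Λ i (y 0)) (E4.ofTimeSpace (y 0) (ξ i (y 0))) (M i) (a i) y - Minkowski.bilin)) x (E4.basisVector 0)‖ₑ) atTop (𝓝 0))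
    (ρ : ℝ → ℝ) (hρ : Tendsto ρ atTop atTop) :
    Tendsto (fun t : ℝ ↦ ⨆ x ∈ {x : E4 | x 0 = t ∧ E4.spatialNorm x ≤ κ * t ∧ ρ t ≤ ⨅ i, ‖E4.spatial x - ξ i t‖},
      ENNReal.ofReal (1 + √(√((⨅ i, ‖E4.spatial x - ξ i t‖) ^ 7))) *
        ‖fderiv ℝ (fun y : E4 ↦ (Minkowski.bilin + ∑ i, (boostedKerrBilin (Λ i (y 0)) (E4.ofTimeSpace (y 0) (ξ i (y 0))) (M i) (a i) y - Minkowski.bilin)) + 𝓢.deviationExtend (⟨U, fun x ↦ Minkowski.bilin + ∑ i, (boostedKerrBilin (Λ i (x 0)) (E4.ofTimeSpace (x 0) (ξ i (x 0))) (M i) (a i) x - Minkowski.bilin), fun x ↦ x 0, E4.spatialNorm⟩ : ModelBackground) Φ y) x (E4.basisVector 0)‖ₑ) atTop (𝓝 0) := by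
  refine tendsto_biSup_zero_of_eventually fun ε hε ↦ ?_
  have hε2 : 0 < ε / 2 := half_pos hε
  filter_upwards [eventually_weighted_abs_sub_le 𝓢 M a rin Λ ξ κ τ₀ U Φ hrin hΛ hξ hU hΦ hWt hρ hε2,
    WindowBounds.quasiStationarity_pointwise (hQ ρ hρ) hε2] with t h1 h2
  rintro x ⟨hx0, hxκ, hxρ⟩
  rw [ofReal_mul_enorm (by positivity)]
  refine ENNReal.ofReal_le_ofReal ?_
  have hA := (h1 x hx0 hxκ hxρ).2
  have hB := h2 x hx0 hxκ hxρ
  rw [abs_le] at hA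
  linarith [hA.1]

-- the algebraic and the operator-norm instance paths on `E4 →L[ℝ] E4 →L[ℝ] ℝ` unify slowly
set_option synthInstance.maxHeartbeats 400000 in
set_option maxHeartbeats 1600000 in
/-- **TFQS ⇒ QS.** Under the hypotheses of `eventually_weighted_abs_sub_le`: if the true lab metric
`G + deviationExtend B Φ = Φ^* g` is quasi-stationary at the weighted rate beyond every `ρ(t) → ∞`,
so is the modulated background `G`. [folklore] -/
theorem quasiStationarity_of_trueField (𝓢 : Spacetime 4) {N : ℕ} (M a rin : Fin N → ℝ)
    (Λ : Fin N → ℝ → lorentzGroup) (ξ : Fin N → ℝ → E3) (κ τ₀ : ℝ) (U : Opens E4)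
    (Φ : U → 𝓢.carrier) (hrin : ∀ i, 0 ≤ rin i)
    (hΛ : ∀ i, ContDiff ℝ ∞ (fun t ↦ ((Λ i t : E4 ≃L[ℝ] E4) : E4 →L[ℝ] E4)))
    (hξ : ∀ i, ContDiff ℝ ∞ (ξ i))
    (hU : {x : E4 | τ₀ < x 0 ∧ ∀ i, rin i < Kerr.radius (a i)
      (poincareInv (Λ i (x 0)) (E4.ofTimeSpace (x 0) (ξ i (x 0))) x)} ⊆ (U : Set E4))
    (hΦ : ContMDiff 𝓘(ℝ, E4) (𝓡 4) ∞ Φ)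
    (hWt : Tendsto (fun t : ℝ ↦ ⨆ x ∈ {x : U | x.1 0 = t ∧ E4.spatialNorm x.1 ≤ κ * t},
      ⨆ (m : ℕ) (_ : m ≤ 3), ENNReal.ofReal (1 + √(√((⨅ i, ‖E4.spatial x.1 - ξ i t‖) ^ 7))) *
        ‖iteratedFDeriv ℝ m (𝓢.deviationExtend (⟨U, fun x ↦ Minkowski.bilin + ∑ i, (boostedKerrBilin (Λ i (x 0)) (E4.ofTimeSpace (x 0) (ξ i (x 0))) (M i) (a i) x - Minkowski.bilin), fun x ↦ x 0, E4.spatialNorm⟩ : ModelBackground) Φ) x.1‖ₑ) atTop (𝓝 0))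
    (hT : ∀ ρ : ℝ → ℝ, Tendsto ρ atTop atTop → Tendsto (fun t : ℝ ↦ ⨆ x ∈ {x : E4 | x 0 = t ∧
      E4.spatialNorm x ≤ κ * t ∧ ρ t ≤ ⨅ i, ‖E4.spatial x - ξ i t‖},
        ENNReal.ofReal (1 + √(√((⨅ i, ‖E4.spatial x - ξ i t‖) ^ 7))) *
          ‖fderiv ℝ (fun y : E4 ↦ (Minkowski.bilin + ∑ i, (boostedKerrBilin (Λ i (y 0)) (E4.ofTimeSpace (y 0) (ξ i (y 0))) (M i) (a i) y - Minkowski.bilin)) + 𝓢.deviationExtend (⟨U, fun x ↦ Minkowski.bilin + ∑ i, (boostedKerrBilin (Λ i (x 0)) (E4.ofTimeSpace (x 0) (ξ i (x 0))) (M i) (a i) x - Minkowski.bilin), fun x ↦ x 0, E4.spatialNorm⟩ : ModelBackground) Φ y) x (E4.basisVector 0)‖ₑ) atTop (𝓝 0))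
    (ρ : ℝ → ℝ) (hρ : Tendsto ρ atTop atTop) :
    Tendsto (fun t : ℝ ↦ ⨆ x ∈ {x : E4 | x 0 = t ∧ E4.spatialNorm x ≤ κ * t ∧ ρ t ≤ ⨅ i, ‖E4.spatial x - ξ i t‖},
      ENNReal.ofReal (1 + √(√((⨅ i, ‖E4.spatial x - ξ i t‖) ^ 7))) *
        ‖fderiv ℝ (fun y : E4 ↦ Minkowski.bilin + ∑ i, (boostedKerrBilin (Λ i (y 0)) (E4.ofTimeSpace (y 0) (ξ i (y 0))) (M i) (a i) y - Minkowski.bilin)) x (E4.basisVector 0)‖ₑ) atTop (𝓝 0) := by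
  refine tendsto_biSup_zero_of_eventually fun ε hε ↦ ?_
  have hε2 : 0 < ε / 2 := half_pos hε
  filter_upwards [eventually_weighted_abs_sub_le 𝓢 M a rin Λ ξ κ τ₀ U Φ hrin hΛ hξ hU hΦ hWt hρ hε2,
    WindowBounds.quasiStationarity_pointwise (hT ρ hρ) hε2] with t h1 h2
  rintro x ⟨hx0, hxκ, hxρ⟩
  rw [ofReal_mul_enorm (by positivity)]
  refine ENNReal.ofReal_le_ofReal ?_
  have hA := (h1 x hx0 hxκ hxρ).2
  have hB := h2 x hx0 hxκ hxρ
  rw [abs_le] at hA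
  linarith [hA.2]

-- the algebraic and the operator-norm instance paths on `E4 →L[ℝ] E4 →L[ℝ] ℝ` unify slowly
set_option synthInstance.maxHeartbeats 400000 in
set_option maxHeartbeats 1600000 in
/-- **QS ⟺ TFQS.** Under the kinematic, domain, smoothness and weighted-`C³` clauses of the crux
antecedent, quasi-stationarity at the weighted rate beyond every exclusion radius `ρ(t) → ∞` holds for
the modulated background `G` if and only if it holds for the true lab metric `G + deviationExtend B Φ`.
[folklore] -/
theorem quasiStationarity_iff_trueField (𝓢 : Spacetime 4) {N : ℕ} (M a rin : Fin N → ℝ)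
    (Λ : Fin N → ℝ → lorentzGroup) (ξ : Fin N → ℝ → E3) (κ τ₀ : ℝ) (U : Opens E4)
    (Φ : U → 𝓢.carrier) (hrin : ∀ i, 0 ≤ rin i)
    (hΛ : ∀ i, ContDiff ℝ ∞ (fun t ↦ ((Λ i t : E4 ≃L[ℝ] E4) : E4 →L[ℝ] E4)))
    (hξ : ∀ i, ContDiff ℝ ∞ (ξ i))
    (hU : {x : E4 | τ₀ < x 0 ∧ ∀ i, rin i < Kerr.radius (a i)
      (poincareInv (Λ i (x 0)) (E4.ofTimeSpace (x 0) (ξ i (x 0))) x)} ⊆ (U : Set E4))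
    (hΦ : ContMDiff 𝓘(ℝ, E4) (𝓡 4) ∞ Φ)
    (hWt : Tendsto (fun t : ℝ ↦ ⨆ x ∈ {x : U | x.1 0 = t ∧ E4.spatialNorm x.1 ≤ κ * t},
      ⨆ (m : ℕ) (_ : m ≤ 3), ENNReal.ofReal (1 + √(√((⨅ i, ‖E4.spatial x.1 - ξ i t‖) ^ 7))) *
        ‖iteratedFDeriv ℝ m (𝓢.deviationExtend (⟨U, fun x ↦ Minkowski.bilin + ∑ i, (boostedKerrBilin (Λ i (x 0)) (E4.ofTimeSpace (x 0) (ξ i (x 0))) (M i) (a i) x - Minkowski.bilin), fun x ↦ x 0, E4.spatialNorm⟩ : ModelBackground) Φ) x.1‖ₑ) atTop (𝓝 0)) :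
    (∀ ρ : ℝ → ℝ, Tendsto ρ atTop atTop → Tendsto (fun t : ℝ ↦ ⨆ x ∈ {x : E4 | x 0 = t ∧
      E4.spatialNorm x ≤ κ * t ∧ ρ t ≤ ⨅ i, ‖E4.spatial x - ξ i t‖},
        ENNReal.ofReal (1 + √(√((⨅ i, ‖E4.spatial x - ξ i t‖) ^ 7))) *
          ‖fderiv ℝ (fun y : E4 ↦ Minkowski.bilin + ∑ i, (boostedKerrBilin (Λ i (y 0)) (E4.ofTimeSpace (y 0) (ξ i (y 0))) (M i) (a i) y - Minkowski.bilin)) x (E4.basisVector 0)‖ₑ) atTop (𝓝 0)) ↔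
    (∀ ρ : ℝ → ℝ, Tendsto ρ atTop atTop → Tendsto (fun t : ℝ ↦ ⨆ x ∈ {x : E4 | x 0 = t ∧
      E4.spatialNorm x ≤ κ * t ∧ ρ t ≤ ⨅ i, ‖E4.spatial x - ξ i t‖},
        ENNReal.ofReal (1 + √(√((⨅ i, ‖E4.spatial x - ξ i t‖) ^ 7))) *
          ‖fderiv ℝ (fun y : E4 ↦ (Minkowski.bilin + ∑ i, (boostedKerrBilin (Λ i (y 0)) (E4.ofTimeSpace (y 0) (ξ i (y 0))) (M i) (a i) y - Minkowski.bilin)) + 𝓢.deviationExtend (⟨U, fun x ↦ Minkowski.bilin + ∑ i, (boostedKerrBilin (Λ i (x 0)) (E4.ofTimeSpace (x 0) (ξ i (x 0))) (M i) (a i) x - Minkowski.bilin), fun x ↦ x 0, E4.spatialNorm⟩ : ModelBackground) Φ y) x (E4.basisVector 0)‖ₑ) atTop (𝓝 0)) :=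
  ⟨fun hQ ρ hρ ↦ trueField_of_quasiStationarity 𝓢 M a rin Λ ξ κ τ₀ U Φ hrin hΛ hξ hU hΦ hWt hQ ρ hρ,
    fun hT ρ hρ ↦ quasiStationarity_of_trueField 𝓢 M a rin Λ ξ κ τ₀ U Φ hrin hΛ hξ hU hΦ hWt hT ρ hρ⟩

end SublinearIsFree.TrueFieldQS

-- the algebraic and the operator-norm instance paths on `E4 →L[ℝ] E4 →L[ℝ] ℝ` unify slowly
set_option synthInstance.maxHeartbeats 400000 in
set_option maxHeartbeats 1600000 in
/-- **Stub `stub_weightedQuasiStationarity` (= item `WeightedQuasiStationarity`, stmt-FinalStateConjecture-16928)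
REDUCED TO TRUE-FIELD QUASI-STATIONARITY.** The registered signature verbatim (crux antecedent, `0 < N`,
third-order slaving block) with ONE hypothesis inserted before the conclusion: TFQS — for every
exclusion radius `ρ(t) → ∞`, the `(1 + d^{7/4})`-weighted sup over the cone-slab points at distance
`d ≥ ρ(t)` from all painted centres of `‖D(G + deviationExtend B Φ)(x)[e₀]‖`, the lab-time derivative of
the TRUE lab metric `Φ^* g` (spelled as in `…StubChargeModelWindowLawMain.windowLaw`), tends to `0`.
Conclusion: QS for the modulated background `G`. Only the smoothness and domain clauses and the `m = 1`
part of the weighted clause of the antecedent are used (`SublinearIsFree.TrueFieldQS.quasiStationarity_of_trueField`);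
`0 < N` and slaving are not. [folklore] -/
theorem weightedQuasiStationarity_of_trueField : ∀ (X : Type) [TopologicalSpace X] [ChartedSpace E3 X] [IsManifold (𝓡 3) ((⊤ : ℕ∞) : WithTop ℕ∞) X] [T2Space X] [SecondCountableTopology X] [ConnectedSpace X], ∀ D ∈ admissibleVacuumData X, ∀ 𝒟 : VacuumCauchyDevelopment D, 𝒟.IsMaximal → ∀ (N : ℕ) (M a rin : Fin N → ℝ) (Λ : Fin N → ℝ → lorentzGroup) (ξ : Fin N → ℝ → E3) (γ κ τ₀ : ℝ) (U : Opens E4) (Φ : U → 𝒟.carrier) (O : Set 𝒟.carrier), ((∀ i, Kerr.IsSubextremal (M i) (a i) ∧ Kerr.rMinus (M i) (a i) < rin i ∧ rin i < Kerr.rPlus (M i) (a i)) ∧ (∀ i t, |((Λ i t : E4 ≃L[ℝ] E4) (E4.basisVector 0)) 0| ≤ γ) ∧ (∀ i, ContDiff ℝ ((⊤ : ℕ∞) : WithTop ℕ∞) (ξ i) ∧ ContDiff ℝ ((⊤ : ℕ∞) : WithTop ℕ∞) (fun t ↦ ((Λ i t : E4 ≃L[ℝ] E4) : E4 →L[ℝ]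 E4))) ∧ (∀ i j, i ≠ j → Tendsto (fun t ↦ ‖ξ i t - ξ j t‖) atTop atTop) ∧ (0 < κ ∧ κ < 1 ∧ ∀ i, ∀ᶠ t in atTop, ‖ξ i t‖ ≤ κ ^ 2 * t) ∧ ({x : E4 | τ₀ < x 0 ∧ ∀ i, rin i < Kerr.radius (a i) (poincareInv (Λ i (x 0)) (E4.ofTimeSpace (x 0) (ξ i (x 0))) x)} ⊆ (U : Set E4)) ∧ let B : ModelBackground := ⟨U, fun x ↦ Minkowski.bilin + ∑ i, (boostedKerrBilin (Λ i (x 0)) (E4.ofTimeSpace (x 0) (ξ i (x 0))) (M i) (a i) x - Minkowski.bilin), fun x ↦ x 0, E4.spatialNorm⟩; ContMDiff 𝓘(ℝ, E4) (𝓡 4) ((⊤ : ℕ∞) : WithTop ℕ∞) Φ ∧ Topology.IsOpenEmbedding ((B.lateRegion τ₀).restrict Φ) ∧ Φ '' {x : U | τ₀ < x.1 0 ∧ ∀ i, Kerr.rPlus (M i) (a i) < Kerr.radius (a i) (poincareInv (Λ i (x.1 0)) (E4.ofTimeSpace (x.1 0) (ξ i (x.1 0))) x.1)} ⊆ O ∧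 Tendsto (fun t ↦ 𝒟.toSpacetime.deviationCk B Φ 3 t) atTop (𝓝 0) ∧ Tendsto (fun t : ℝ ↦ ⨆ x ∈ {x : U | x.1 0 = t ∧ E4.spatialNorm x.1 ≤ κ * t}, ⨆ (m : ℕ) (_ : m ≤ 3), ENNReal.ofReal (1 + √(√((⨅ i, ‖E4.spatial x.1 - ξ i t‖) ^ 7))) * ‖iteratedFDeriv ℝ m (𝒟.toSpacetime.deviationExtend B Φ) x.1‖ₑ) atTop (𝓝 0) ∧ O = Summit.FinalStateConjecture.exteriorOf 𝒟.toCauchyDevelopment (Φ '' {x : U | τ₀ < x.1 0 ∧ ∀ i, Kerr.rPlus (M i) (a i) < Kerr.radius (a i) (poincareInv (Λ i (x.1 0)) (E4.ofTimeSpace (x.1 0) (ξ i (x.1 0))) x.1)}) ∧ ∀ t₁ : ℝ, τ₀ < t₁ → O \ Φ '' {x : U | t₁ < x.1 0 ∧ ∀ i, Kerr.rPlus (M i) (a i) < Kerr.radius (a i) (poincareInv (Λ i (x.1 0)) (E4.ofTimeSpace (x.1 0) (ξ i (x.1 0))) x.1)} ⊆ 𝒟.metric.causalPast 𝒟.timeOrientation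 (Φ '' {x : U | x.1 0 = t₁ ∧ ∀ i, Kerr.rPlus (M i) (a i) < Kerr.radius (a i) (poincareInv (Λ i (x.1 0)) (E4.ofTimeSpace (x.1 0) (ξ i (x.1 0))) x.1)})) → 0 < N → (∀ i : Fin N, (∀ m : ℕ, 1 ≤ m → m ≤ 3 → Tendsto (fun t ↦ iteratedDeriv m (fun s ↦ (((Λ i s : lorentzGroup) : E4 ≃L[ℝ] E4) (E4.basisVector 0))) t) atTop (𝓝 0)) ∧ (∀ m : ℕ, m ≤ 2 → Tendsto (fun t ↦ iteratedDeriv m (fun s ↦ deriv (ξ i) s - (((((Λ i s : lorentzGroup) : E4 ≃L[ℝ] E4) (E4.basisVector 0)) 0)⁻¹ • E4.spatial (((Λ i s : lorentzGroup) : E4 ≃L[ℝ] E4) (E4.basisVector 0)))) t) atTop (𝓝 0)) ∧ (a i ≠ 0 → ∀ m : ℕ, 1 ≤ m → m ≤ 3 → Tendsto (fun t ↦ iteratedDeriv m (fun s ↦ (((Λ i s : lorentzGroup) : E4 ≃L[ℝ] E4) (E4.basisVector 3))) t) atTop (𝓝 0))) → (∀ ρ : ℝ → ℝ, Tendsto ρ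 atTop atTop → Tendsto (fun t : ℝ ↦ ⨆ x ∈ {x : E4 | x 0 = t ∧ E4.spatialNorm x ≤ κ * t ∧ ρ t ≤ ⨅ i, ‖E4.spatial x - ξ i t‖}, ENNReal.ofReal (1 + √(√((⨅ i, ‖E4.spatial x - ξ i t‖) ^ 7))) * ‖fderiv ℝ (fun y : E4 ↦ (Minkowski.bilin + ∑ i, (boostedKerrBilin (Λ i (y 0)) (E4.ofTimeSpace (y 0) (ξ i (y 0))) (M i) (a i) y - Minkowski.bilin)) + 𝒟.toSpacetime.deviationExtend (⟨U, fun x ↦ Minkowski.bilin + ∑ i, (boostedKerrBilin (Λ i (x 0)) (E4.ofTimeSpace (x 0) (ξ i (x 0))) (M i) (a i) x - Minkowski.bilin), fun x ↦ x 0, E4.spatialNorm⟩ : ModelBackground) Φ y) x (E4.basisVector 0)‖ₑ) atTop (𝓝 0)) → (∀ ρ : ℝ → ℝ, Tendsto ρ atTop atTop → Tendsto (fun t : ℝ ↦ ⨆ x ∈ {x : E4 | x 0 = t ∧ E4.spatialNorm x ≤ κ * t ∧ ρ t ≤ ⨅ i, ‖E4.spatial x - ξ i t‖}, ENNReal.ofReal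 (1 + √(√((⨅ i, ‖E4.spatial x - ξ i t‖) ^ 7))) * ‖fderiv ℝ (fun y : E4 ↦ Minkowski.bilin + ∑ i, (boostedKerrBilin (Λ i (y 0)) (E4.ofTimeSpace (y 0) (ξ i (y 0))) (M i) (a i) y - Minkowski.bilin)) x (E4.basisVector 0)‖ₑ) atTop (𝓝 0)) := by
  intro X _ _ _ _ _ _ D _hD 𝒟 _h𝒟 N M a rin Λ ξ γ κ τ₀ U Φ O hant _hN _hslaved hT ρ hρ
  obtain ⟨hsub, -, hsmooth, -, -, hU, hrest⟩ := hant
  obtain ⟨hΦ, -, -, -, hWt, -, -⟩ := hrest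
  have hrin : ∀ i, 0 ≤ rin i := fun i ↦ (hsub i).1.rMinus_nonneg.trans (hsub i).2.1.le
  exact SublinearIsFree.TrueFieldQS.quasiStationarity_of_trueField 𝒟.toSpacetime M a rin Λ ξ κ τ₀ U Φ
    hrin (fun i ↦ (hsmooth i).2) (fun i ↦ (hsmooth i).1) hU hΦ hWt hT ρ hρ

-- the algebraic and the operator-norm instance paths on `E4 →L[ℝ] E4 →L[ℝ] ℝ` unify slowly
set_option synthInstance.maxHeartbeats 400000 in
set_option maxHeartbeats 1600000 in
/-- **Converse: the registered stub's conclusion QS implies TFQS** under the same antecedent (so that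
the reduction `weightedQuasiStationarity_of_trueField` loses nothing: under the antecedent QS and TFQS are
the same statement). Signature: the registered one with the conclusion moved to the hypotheses and TFQS
as the conclusion. [folklore] -/
theorem trueField_of_weightedQuasiStationarity : ∀ (X : Type) [TopologicalSpace X] [ChartedSpace E3 X] [IsManifold (𝓡 3) ((⊤ : ℕ∞) : WithTop ℕ∞) X] [T2Space X] [SecondCountableTopology X] [ConnectedSpace X], ∀ D ∈ admissibleVacuumData X, ∀ 𝒟 : VacuumCauchyDevelopment D, 𝒟.IsMaximal → ∀ (N : ℕ) (M a rin : Fin N → ℝ) (Λ : Fin N → ℝ → lorentzGroup) (ξ : Fin N → ℝ → E3) (γ κ τ₀ : ℝ) (U : Opens E4) (Φ : U → 𝒟.carrier) (O : Set 𝒟.carrier), ((∀ i, Kerr.IsSubextremal (M i) (a i) ∧ Kerr.rMinus (M i) (a i) < rin i ∧ rin i < Kerr.rPlus (M i) (a i)) ∧ (∀ i t, |((Λ i t : E4 ≃L[ℝ] E4) (E4.basisVector 0)) 0| ≤ γ) ∧ (∀ i, ContDiff ℝ ((⊤ : ℕ∞) : WithTop ℕ∞) (ξ i) ∧ ContDiff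 ℝ ((⊤ : ℕ∞) : WithTop ℕ∞) (fun t ↦ ((Λ i t : E4 ≃L[ℝ] E4) : E4 →L[ℝ] E4))) ∧ (∀ i j, i ≠ j → Tendsto (fun t ↦ ‖ξ i t - ξ j t‖) atTop atTop) ∧ (0 < κ ∧ κ < 1 ∧ ∀ i, ∀ᶠ t in atTop, ‖ξ i t‖ ≤ κ ^ 2 * t) ∧ ({x : E4 | τ₀ < x 0 ∧ ∀ i, rin i < Kerr.radius (a i) (poincareInv (Λ i (x 0)) (E4.ofTimeSpace (x 0) (ξ i (x 0))) x)} ⊆ (U : Set E4)) ∧ let B : ModelBackground := ⟨U, fun x ↦ Minkowski.bilin + ∑ i, (boostedKerrBilin (Λ i (x 0)) (E4.ofTimeSpace (x 0) (ξ i (x 0))) (M i) (a i) x - Minkowski.bilin), fun x ↦ x 0, E4.spatialNorm⟩; ContMDiff 𝓘(ℝ, E4) (𝓡 4) ((⊤ : ℕ∞) : WithTop ℕ∞) Φ ∧ Topology.IsOpenEmbedding ((B.lateRegion τ₀).restrict Φ) ∧ Φ '' {x : U | τ₀ < x.1 0 ∧ ∀ i, Kerr.rPlus (M i) (a i) < Kerr.radius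 (a i) (poincareInv (Λ i (x.1 0)) (E4.ofTimeSpace (x.1 0) (ξ i (x.1 0))) x.1)} ⊆ O ∧ Tendsto (fun t ↦ 𝒟.toSpacetime.deviationCk B Φ 3 t) atTop (𝓝 0) ∧ Tendsto (fun t : ℝ ↦ ⨆ x ∈ {x : U | x.1 0 = t ∧ E4.spatialNorm x.1 ≤ κ * t}, ⨆ (m : ℕ) (_ : m ≤ 3), ENNReal.ofReal (1 + √(√((⨅ i, ‖E4.spatial x.1 - ξ i t‖) ^ 7))) * ‖iteratedFDeriv ℝ m (𝒟.toSpacetime.deviationExtend B Φ) x.1‖ₑ) atTop (𝓝 0) ∧ O = Summit.FinalStateConjecture.exteriorOf 𝒟.toCauchyDevelopment (Φ '' {x : U | τ₀ < x.1 0 ∧ ∀ i, Kerr.rPlus (M i) (a i) < Kerr.radius (a i) (poincareInv (Λ i (x.1 0)) (E4.ofTimeSpace (x.1 0) (ξ i (x.1 0))) x.1)}) ∧ ∀ t₁ : ℝ, τ₀ < t₁ → O \ Φ '' {x : U | t₁ < x.1 0 ∧ ∀ i, Kerr.rPlus (M i) (a i) < Kerr.radius (a i) (poincareInv (Λ i (x.1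 0)) (E4.ofTimeSpace (x.1 0) (ξ i (x.1 0))) x.1)} ⊆ 𝒟.metric.causalPast 𝒟.timeOrientation (Φ '' {x : U | x.1 0 = t₁ ∧ ∀ i, Kerr.rPlus (M i) (a i) < Kerr.radius (a i) (poincareInv (Λ i (x.1 0)) (E4.ofTimeSpace (x.1 0) (ξ i (x.1 0))) x.1)})) → 0 < N → (∀ i : Fin N, (∀ m : ℕ, 1 ≤ m → m ≤ 3 → Tendsto (fun t ↦ iteratedDeriv m (fun s ↦ (((Λ i s : lorentzGroup) : E4 ≃L[ℝ] E4) (E4.basisVector 0))) t) atTop (𝓝 0)) ∧ (∀ m : ℕ, m ≤ 2 → Tendsto (fun t ↦ iteratedDeriv m (fun s ↦ deriv (ξ i) s - (((((Λ i s : lorentzGroup) : E4 ≃L[ℝ] E4) (E4.basisVector 0)) 0)⁻¹ • E4.spatial (((Λ i s : lorentzGroup) : E4 ≃L[ℝ] E4) (E4.basisVector 0)))) t) atTop (𝓝 0)) ∧ (a i ≠ 0 → ∀ m : ℕ, 1 ≤ m → m ≤ 3 → Tendsto (fun t ↦ iteratedDeriv m (fun s ↦ (((Λ i s : lorentzGroup)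 : E4 ≃L[ℝ] E4) (E4.basisVector 3))) t) atTop (𝓝 0))) → (∀ ρ : ℝ → ℝ, Tendsto ρ atTop atTop → Tendsto (fun t : ℝ ↦ ⨆ x ∈ {x : E4 | x 0 = t ∧ E4.spatialNorm x ≤ κ * t ∧ ρ t ≤ ⨅ i, ‖E4.spatial x - ξ i t‖}, ENNReal.ofReal (1 + √(√((⨅ i, ‖E4.spatial x - ξ i t‖) ^ 7))) * ‖fderiv ℝ (fun y : E4 ↦ Minkowski.bilin + ∑ i, (boostedKerrBilin (Λ i (y 0)) (E4.ofTimeSpace (y 0) (ξ i (y 0))) (M i) (a i) y - Minkowski.bilin)) x (E4.basisVector 0)‖ₑ) atTop (𝓝 0)) → (∀ ρ : ℝ → ℝ, Tendsto ρ atTop atTop → Tendsto (fun t : ℝ ↦ ⨆ x ∈ {x : E4 | x 0 = t ∧ E4.spatialNorm x ≤ κ * t ∧ ρ t ≤ ⨅ i, ‖E4.spatial x - ξ i t‖}, ENNReal.ofReal (1 + √(√((⨅ i, ‖E4.spatial x - ξ i t‖) ^ 7))) * ‖fderiv ℝ (fun y : E4 ↦ (Minkowski.bilin + ∑ i, (boostedKerrBilin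 (Λ i (y 0)) (E4.ofTimeSpace (y 0) (ξ i (y 0))) (M i) (a i) y - Minkowski.bilin)) + 𝒟.toSpacetime.deviationExtend (⟨U, fun x ↦ Minkowski.bilin + ∑ i, (boostedKerrBilin (Λ i (x 0)) (E4.ofTimeSpace (x 0) (ξ i (x 0))) (M i) (a i) x - Minkowski.bilin), fun x ↦ x 0, E4.spatialNorm⟩ : ModelBackground) Φ y) x (E4.basisVector 0)‖ₑ) atTop (𝓝 0)) := by
  intro X _ _ _ _ _ _ D _hD 𝒟 _h𝒟 N M a rin Λ ξ γ κ τ₀ U Φ O hant _hN _hslaved hQ ρ hρ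
  obtain ⟨hsub, -, hsmooth, -, -, hU, hrest⟩ := hant
  obtain ⟨hΦ, -, -, -, hWt, -, -⟩ := hrest
  have hrin : ∀ i, 0 ≤ rin i := fun i ↦ (hsub i).1.rMinus_nonneg.trans (hsub i).2.1.le
  exact SublinearIsFree.TrueFieldQS.trueField_of_quasiStationarity 𝒟.toSpacetime M a rin Λ ξ κ τ₀ U Φ
    hrin (fun i ↦ (hsmooth i).2) (fun i ↦ (hsmooth i).1) hU hΦ hWt hQ ρ hρ

/-- Registered sub-goal form (stub `weight_abs_sub_le_qs11` of the crux item; carrier of this file,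
whose content — the reduction `weightedQuasiStationarity_of_trueField` of `stub_weightedQuasiStationarity`
to true-field quasi-stationarity and its converse — has statements exceeding the stub-signature size
limit) of `SublinearIsFree.TrueFieldQS.abs_weight_mul_norm_sub_le`: the weighted reverse triangle
inequality `|w‖u‖ − w‖u + v‖| ≤ w‖v‖` on the space of lab metric derivatives. [folklore] -/
theorem weight_abs_sub_le_qs11 : open Literature.Geometry.Lorentzian in ∀ (w : ℝ) (u v : E4 →L[ℝ] E4 →L[ℝ] ℝ), 0 ≤ w → |w * ‖u‖ - w * ‖u + v‖| ≤ w * ‖v‖ :=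
  fun _ u v hw ↦ SublinearIsFree.TrueFieldQS.abs_weight_mul_norm_sub_le hw u v

end Summit.FinalStateConjecture.FinalStateConjecture.Theorems

end
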